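import Summits.QuantumAdvantage.QuantumAdvantage.Theses.KummerSector

/-!
# Refutation of `KummerSector.KsNotFrobenian` (stmt-QuantumAdvantage-1615)

The crux quantifies over ALL finite lists `fs : List (Polynomial ℤ)`, including lists containing
the zero polynomial. For `f = 0` the "number of roots of `f` mod `p`",
`#{x < p : (p : ℤ) ∣ f.eval x}`, equals `p` itself, so the Frobenian datum
`(p % m, root counts)` with `m = 1`, `fs = [0]` is `(0, [p])` and DETERMINES `p`; taking
`D := {datum p : p ∈ KS}` (the image of Kummer's class I) and `N := 0` gives an exact eventual
description of Kummer's class by the datum, contradicting the statement. The intended statement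
needs the side condition `∀ f ∈ fs, f ≠ 0` (then root counts are eventually `≤ natDegree f` and the
datum takes finitely many values), under which the crux is the genuine (open, Patterson-type)
non-Frobenian claim. Route review 2026-08-15, refuter-rreview-route-QuantumAdvantage-I-d39967b4-0.
The refuted decl was then dropped from the route (repaired as `KsNotFrobenianR`); it is re-created
privately below, so the theorem's (append-only) statement is unchanged and nothing depends on the
retired route name.
-/

/-- PRIVATE re-creation (route namespace stays free; a refuted statement, NOT a cited fact) of the
route decl `…Theses.KummerSector.KsNotFrobenian`, stmt-QuantumAdvantage-1615, DROPPED from the route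
(2026-08-15T21:20:47Z; repaired as `KsNotFrobenianR`, non-zero polynomials) after the refutation
below, so the name left `Theses/KummerSector.lean` (full-build breakage 2026-08-16,
`Unknown identifier`): the item's recorded signature verbatim, so that the append-only refuting
theorem (which names it through the `open` below) keeps elaborating. -/
private def Summit.QuantumAdvantage.QuantumAdvantage.Theses.KummerSector.KsNotFrobenian : Prop :=
  ∀ (m : ℕ) (fs : List (Polynomial ℤ)), 0 < m → ¬ ∃ (D : Set (ℕ × List ℕ)) (N : ℕ), ∀ p : ℕ, N ≤ p →
    p.Prime → p % 3 = 1 →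
      (Real.sqrt (p : ℝ) < ∑ x ∈ Finset.range p, Real.cos (2 * Real.pi * (x : ℝ) ^ 3 / (p : ℝ)) ↔
        (p % m, fs.map (fun f => ((Finset.range p).filter (fun x => (p : ℤ) ∣ f.eval (x : ℤ))).card))
          ∈ D)

namespace Summit.QuantumAdvantage.QuantumAdvantage.Theorems

open Summit.QuantumAdvantage.QuantumAdvantage.Theses.KummerSector

/-- Refutes `KummerSector.KsNotFrobenian`: with `m = 1` and `fs = [0]` (the zero polynomial, whose
root count mod `p` is `p`), the datum `(p % 1, [p])` determines the prime `p`, so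
`D := {(p % 1, [p]) : p ∈ KS}`, `N := 0` describe Kummer's class I exactly; witness `fs = [0]`.
[folklore] -/
theorem KummerSectorKsNotFrobenian_refuted : ¬ KsNotFrobenian := by
  intro h
  apply h 1 [0] one_pos
  refine ⟨{d | ∃ p : ℕ, (Real.sqrt (p : ℝ) <
      ∑ x ∈ Finset.range p, Real.cos (2 * Real.pi * (x : ℝ) ^ 3 / (p : ℝ))) ∧
    d = (p % 1, [(0 : Polynomial ℤ)].map
      (fun f => ((Finset.range p).filter (fun x => (p : ℤ) ∣ f.eval (x : ℤ))).card))}, 0, ?_⟩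
  intro p _ _ _
  have key : ∀ q : ℕ, [(0 : Polynomial ℤ)].map
      (fun f => ((Finset.range q).filter (fun x => (q : ℤ) ∣ f.eval (x : ℤ))).card) = [q] := by
    intro q
    simp
  constructor
  · intro hKS
    exact ⟨p, hKS, rfl⟩
  · intro hmem
    obtain ⟨p', hKS', hd⟩ := hmem
    rw [key, key] at hd
    have hpp : p = p' := by
      have := (Prod.mk.inj hd).2
      simpa using this
    subst hpp
    exact hKS'

end Summit.QuantumAdvantage.QuantumAdvantage.Theorems
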